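import Summits.HodgeConjecture.HodgeConjecture.Theorems.WeilTypeLadderFermatTwentyFour
import Summits.HodgeConjecture.HodgeConjecture.Theorems.WeilTypeLadderProducts
import Literature.AlgebraicGeometry.HodgeTheory.SimplePrimeDimensionHodgeClasses
import HarnessLib

/-!
# Weil-type ladder — SQUARES OF SIMPLE THREEFOLDS: the rungs R1/R1′/R6 (and R2₈ on products) at the sixfolds isogenous to `T × T`, classically

B2b ladder `hodge-weil` (HOME `run/shared/lean/b2b/hodge-weil/`, CENSUS.md `## P3-g4`), prover 3 generation 4
(strategy: special cases with CLASSICAL tools). Helper of the route item `WeilSixfolds` (R1,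
stmt-HodgeConjecture-2524). No `sorry`, no new definition; conditional ONLY on the refereed named fact
`TankeevRibet1983_hodgeClasses_divisorial_powers_simplePrimeDimension` (Tankeev 1982 / Ribet 1983 as
restated VERBATIM by Moonen–Zarhin, Math. Ann. 315 (1999) Thm. (2.7): "Let `X` be a simple complex abelian
variety such that `dim(X)` is a prime number. Then `Hg(X) = Sp_D(V,φ)` and `B•(Xⁿ) = D•(Xⁿ)` for every
`n ≥ 1`"; tree file `Literature/AlgebraicGeometry/HodgeTheory/SimplePrimeDimensionHodgeClasses`, p177550).
Markman 2025 is not used; Schoen is not used; nothing depends on `K`.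

## What is typed here

* `hodgeClasses_algebraic_isogenyFactor_powSucc_simplePrimeDimension` /
  `hodgeConjectureFor_isogenyFactor_powSucc_simplePrimeDimension` — the Hodge conjecture (cycle part, every
  codimension; resp. the summit layer's `HodgeConjectureFor A.dim A.X`) for every ISOGENY FACTOR `A`
  (`i : A ⟶ T^{N+1}`, `q : T^{N+1} ⟶ A`, `i ≫ q = n • 𝟙 A`, `0 < n`) of a power `T^{N+1} = T.powSucc N` of a
  SIMPLE abelian variety `T` of PRIME dimension: the fact gives `B = D` on `T^{N+1}`, `D ⊗ ℂ ⊆ N` is the tree's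
  theorem (Lefschetz `(1,1)` discharged), and Hodge classes descend to isogeny factors
  (`Theorems.hodgeClasses_algebraic_of_isogenyFactor`, unconditional).
* `p = 3`, `N = 1` — **SIXFOLDS isogenous to (an isogeny factor of) the square `T × T` of a simple abelian
  threefold**: `hodgeConjectureFor_isogenyFactor_sq_simpleThreefold`, `hodgeConjectureFor_sq_simpleThreefold`,
  and the BODIES of the ladder's rungs at these sixfolds, for EVERY `φ² = -d` on them:
  R1 = `WeilSixfolds` (`weilClasses_algebraic_sixfold_of_isogenyFactor_sq_simpleThreefold`, `weilClassesOf`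
  form), R1′ = `NonsplitSixfolds` (`nonsplitSixfolds_body_of_isogenyFactor_sq_simpleThreefold`, its
  non-hyperbolicity hypothesis carried and unused), R6 = `AbelianSixfolds`
  (`abelianSixfolds_body_of_isogenyFactor_sq_simpleThreefold`); the submodule form
  `weilClassesOf A φ 3 d ≤ N³` for balanced `φ` (`weilClassesOf_le_algebraicClasses_of_isogenyFactor_sq_simpleThreefold`).
* EIGHTFOLDS `A × S` (`A` as above with `φ` balanced, `S` an abelian surface of Weil type `(1,1)`): the body of
  R2₈ = `SplitEightfolds` / R∞(`n = 4`) (`splitEightfolds_body_sqSimpleThreefold_prod_surface`), by the tree's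
  downward product step `weilClassesOf_prod_le_algebraicClasses` (p177044) — trust base {Tankeev–Ribet,
  Lefschetz (1,1)}, all `K`, no Markman, no Schoen.
* ON-PATH (forward contract): `HodgeConjecture →` each statement
  (`hodgeConjectureFor_abelianVariety_of_hodgeConjecture`, `weilSixfolds_…_of_hodgeConjecture`,
  `splitEightfolds_prod_of_hodgeConjecture` — the last two from the sibling files, re-instantiated here).
* `p = 7`, `N = 0`: the Tankeev–Ribet sector of the census crux X1 is the separate helper file
  `Theorems/SevenfoldWeilCensusCodimThreeWeilGenerationSimplePrimeSeven`.

## Which Weil sixfolds these are (pen-and-paper dictionary, CENSUS.md ## P3-g4; NOT typed — no signature /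
discriminant on the carriers, DIVERGENCE D4/D12)

Let `K = ℚ(√-d)` and `(A, K)` an abelian sixfold of Weil type `(3,3)`. Up to `K`-equivariant isogeny,
`A ~ ∏ Bᵢ^{kᵢ}` with `K ↪ M_{kᵢ}(End⁰Bᵢ)` on each isotypic block. The blocks isogenous to the SQUARE OF A
SIMPLE THREEFOLD `T` are exactly the sixfolds covered here, whatever the `K`-structure:
(i) `(T², K ⊂ M₂(ℚ) ⊂ M₂(End⁰T))` for EVERY simple threefold `T` and EVERY `K` (signature `(3,3)`
automatically: `H^{1,0}(T²) = H^{1,0}(T) ⊗ K`; discriminant `-1`, SPLIT — a Lagrangian of `H₁(T,ℚ)`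
tensored with `K` is isotropic); (ii) `(T², K ⊂ M₂(End⁰T))` in general (`End⁰T` a cubic totally real field,
an imaginary quadratic `K'`, or a sextic CM field); (iii) the TWISTED SQUARES `(T × T, ι × ῑ)` of the simple
threefolds `T` with `ι : K ↪ End⁰(T)` — then `K` acts on `H^{1,0}(T)` with multiplicities `(2,1)` (Shimura;
Moonen–Zarhin (2.4): "`(3,0)` is excluded"), the general such `T` has `End⁰(T) = K` and moves in the
`2`-dimensional Picard modular family, and `(T × T, ι × ῑ)` has signature `(2,1) + (1,2) = (3,3)`. For (iii):
every polarization `aL₀ ⊞ bL₀` (`a, b ∈ ℚ_{>0}`) is `K`-compatible (the Rosati involution of a CM field is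
complex conjugation) with van Geemen Hermitian form `aH ⊕ b(-H̄)`, `det = -a³b³(det H)² ≡ -ab mod Nm(K^×)`:
EVERY class of `ℚ_{<0}/Nm(K^×)` — i.e. every discriminant of a polarized Weil-type sixfold, split (`-1`) or
NON-split — occurs. Since components of the moduli of polarized abelian sixfolds of Weil type with the same
`(K, det H)` parametrize `K`-isogenous varieties (van Geemen LNM 1594 (5.4); Markman arXiv:2509.23403 §11.5
Step 1) and the theorems below are stated for isogeny factors, EVERY component `(K, 3, δ)`, for EVERY
imaginary quadratic `K`, contains a `2`-dimensional locus (twisted squares of Picard-type threefolds, and their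
`K`-isogenous images) on which ALL Hodge classes — in particular the Weil classes — are algebraic by a
REFEREED theorem of 1982/83. Compare CENSUS ## P3-g3 (product loci `X⁴ × S_D`: 5-dimensional, but needing
Markman 2023 JEMS Thm. 1.3 for general `K`, Schoen 1988 for `K ∈ {ℚ(i), ℚ(√-3)}`) and ## P3 (CM points). The
factors `(T, ι)`, `(T, ῑ)` have ODD `K`-rank `3`, so neither the product step (balanced factors) nor F1 applies
to (iii); Markman's Thm. 1.5.1 would cover the split-polarized members only (and is unrefereed).

Honest framing: CASES of the summit on `2`-dimensional (resp. isotypic) special loci, classical theorem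
repackaged on the tree's carriers; NOT general members of any component ("outside this locus [δ = -1], the
Hodge conjecture for Weil classes on sixfolds remains completely open", Mostaed arXiv:2603.20268 p. 3 — for
the general member, unchanged); unconditional rungs above the floor added: 0; trust base {Tankeev 1982,
Ribet 1983} (+ Lefschetz (1,1), proved in the tree, for the eightfold products).
-/

noncomputable section

-- every declaration of this problem lives in Summit.HodgeConjecture.HodgeConjecture.… (summit = sub-problem)
set_option linter.dupNamespace false

open CategoryTheory
open Literature.AlgebraicGeometry Literature.AlgebraicGeometry.Motives
open Literature.AlgebraicGeometry.HodgeTheory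
open Literature.AlgebraicTopology.SingularHomology
open Summit.HodgeConjecture.HodgeConjecture.Theorems

namespace Summit.HodgeConjecture.HodgeConjecture.WeilTypeLadder

/-! ### Isogeny factors of powers of simple abelian varieties of prime dimension -/

/-- **The Hodge conjecture — cycle part, every codimension — for every ISOGENY FACTOR `A` of a power
`T^{N+1}` of a simple complex abelian variety `T` of prime dimension `p`**, modulo Tankeev–Ribet: Hodge classes
on `T^{N+1}` are algebraic (`hodgeClasses_algebraic_powSucc_of_tankeevRibet`: `B = D ⊆ N`), and Hodge classes
descend to isogeny factors (`Theorems.hodgeClasses_algebraic_of_isogenyFactor`: `q^*c` is algebraic on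
`T^{N+1}`, `i^*q^*c = n^{2m} c`). Covers every abelian variety isogenous to `T^k`, `1 ≤ k ≤ N + 1`, every
abelian subvariety and every quotient of these (Poincaré reducibility).
[cite: MoonenZarhin1999LowDim, §2 Thm. (2.7)] [cite: MumfordAV1970, §19 Thm. 1] -/
theorem hodgeClasses_algebraic_isogenyFactor_powSucc_simplePrimeDimension
    (hTR : TankeevRibet1983_hodgeClasses_divisorial_powers_simplePrimeDimension)
    (T : AbelianVariety ℂ) {p : ℕ} (hp : p.Prime) (hT : T.dim = p) (hs : T.IsSimple) (N : ℕ)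
    (A : AbelianVariety ℂ) (i : A ⟶ T.powSucc N) (q : T.powSucc N ⟶ A) (n : ℕ) (hn : 0 < n)
    (hiq : i ≫ q = n • 𝟙 A) (m : ℕ) (c : complexBetti A.X (2 * m)) (hc : IsRationalClass c)
    (hmm : IsOfHodgeType A.dim A.X (2 * m) m m c) : c ∈ algebraicClasses A.X m :=
  hodgeClasses_algebraic_of_isogenyFactor (T.powSucc N) A i q n hn hiq
    (fun m' b hb hbb ↦ hodgeClasses_algebraic_powSucc_of_tankeevRibet hTR T hp hT hs N m' b hb hbb)
    m c hc hmm

/-- **Summit-layer spelling: `HodgeConjectureFor A.dim A.X` for every isogeny factor `A` of a power of a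
simple complex abelian variety of prime dimension**, modulo Tankeev–Ribet (Hodge-model conjunct: the tree's
theorem `nonempty_hodgeModel_holds`). [cite: MoonenZarhin1999LowDim, §2 Thm. (2.7)] [cite: Deligne2000, §1] -/
theorem hodgeConjectureFor_isogenyFactor_powSucc_simplePrimeDimension
    (hTR : TankeevRibet1983_hodgeClasses_divisorial_powers_simplePrimeDimension)
    (T : AbelianVariety ℂ) {p : ℕ} (hp : p.Prime) (hT : T.dim = p) (hs : T.IsSimple) (N : ℕ)
    (A : AbelianVariety ℂ) (i : A ⟶ T.powSucc N) (q : T.powSucc N ⟶ A) (n : ℕ) (hn : 0 < n)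
    (hiq : i ≫ q = n • 𝟙 A) : HodgeConjectureFor A.dim A.X :=
  ⟨nonempty_hodgeModel_holds (AbelianVariety.isSmoothProjective_holds (A := A)),
    fun m c hc hmm ↦ hodgeClasses_algebraic_isogenyFactor_powSucc_simplePrimeDimension hTR T hp hT hs N
      A i q n hn hiq m c hc hmm⟩

/-! ### Sixfolds: isogeny factors of `T × T`, `T` a simple abelian THREEFOLD (`p = 3`, `N = 1`) -/

/-- **The Hodge conjecture for every complex abelian variety that is an isogeny factor of `T × T`, `T` a SIMPLE
abelian THREEFOLD** (e.g. every sixfold isogenous to `T × T`), modulo Tankeev–Ribet (`3` is prime;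
`T.powSucc 1 = T × T`). [cite: MoonenZarhin1999LowDim, §2 Thm. (2.7)] [cite: vanGeemen1994HodgeAV, Thm. 4.6] -/
theorem hodgeConjectureFor_isogenyFactor_sq_simpleThreefold
    (hTR : TankeevRibet1983_hodgeClasses_divisorial_powers_simplePrimeDimension)
    (T : AbelianVariety ℂ) (hT : T.dim = 3) (hs : T.IsSimple)
    (A : AbelianVariety ℂ) (i : A ⟶ T.prod T) (q : T.prod T ⟶ A) (n : ℕ) (hn : 0 < n)
    (hiq : i ≫ q = n • 𝟙 A) : HodgeConjectureFor A.dim A.X :=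
  hodgeConjectureFor_isogenyFactor_powSucc_simplePrimeDimension hTR T Nat.prime_three hT hs 1 A i q n
    hn hiq

/-- The cycle part of the previous theorem in the shape of the census cruxes (`IsOfHodgeType A.dim …`).
[cite: MoonenZarhin1999LowDim, §2 Thm. (2.7)] -/
theorem hodgeClasses_algebraic_isogenyFactor_sq_simpleThreefold
    (hTR : TankeevRibet1983_hodgeClasses_divisorial_powers_simplePrimeDimension)
    (T : AbelianVariety ℂ) (hT : T.dim = 3) (hs : T.IsSimple)
    (A : AbelianVariety ℂ) (i : A ⟶ T.prod T) (q : T.prod T ⟶ A) (n : ℕ) (hn : 0 < n)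
    (hiq : i ≫ q = n • 𝟙 A) (m : ℕ) (c : complexBetti A.X (2 * m)) (hc : IsRationalClass c)
    (hmm : IsOfHodgeType A.dim A.X (2 * m) m m c) : c ∈ algebraicClasses A.X m :=
  hodgeClasses_algebraic_isogenyFactor_powSucc_simplePrimeDimension hTR T Nat.prime_three hT hs 1 A i q
    n hn hiq m c hc hmm

/-- **The square itself**: `HodgeConjectureFor (T × T).dim (T × T).X` for every simple abelian threefold `T`
(`i = q = 𝟙`), modulo Tankeev–Ribet. [cite: MoonenZarhin1999LowDim, §2 Thm. (2.7)] -/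
theorem hodgeConjectureFor_sq_simpleThreefold
    (hTR : TankeevRibet1983_hodgeClasses_divisorial_powers_simplePrimeDimension)
    (T : AbelianVariety ℂ) (hT : T.dim = 3) (hs : T.IsSimple) :
    HodgeConjectureFor (T.prod T).dim (T.prod T).X :=
  hodgeConjectureFor_isogenyFactor_sq_simpleThreefold hTR T hT hs (T.prod T) (𝟙 _) (𝟙 _) 1 one_pos
    (by simp)

/-- **Rung R1 (`WeilSixfolds`, stmt-HodgeConjecture-2524) AT the sixfolds that are isogeny factors of `T × T`,
`T` a simple threefold — for EVERY `φ` and EVERY `d`** (its body in the `weilClassesOf` form of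
`weilSixfolds_iff_weilClassesOf`, with no hypothesis on `φ` or on polarizations: so on the isotypic stratum
`(T², K ⊂ M₂(End⁰T))` AND on the twisted squares `T × T̄` of Picard-type threefolds, which meet every
component `(K, 3, δ)`, split or not — module docstring). Modulo Tankeev–Ribet only.
[cite: MoonenZarhin1999LowDim, §2 Thm. (2.7)] [cite: vanGeemen1994HodgeAV, Thm. 4.6, 5.2, 5.4]
[cite: Markman2025SurveySecant, §11.5 Step 1] -/
theorem weilClasses_algebraic_sixfold_of_isogenyFactor_sq_simpleThreefold
    (hTR : TankeevRibet1983_hodgeClasses_divisorial_powers_simplePrimeDimension)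
    (T : AbelianVariety ℂ) (hT : T.dim = 3) (hs : T.IsSimple)
    (A : AbelianVariety ℂ) (i : A ⟶ T.prod T) (q : T.prod T ⟶ A) (n : ℕ) (hn : 0 < n)
    (hiq : i ≫ q = n • 𝟙 A) (hA : A.dim = 2 * 3) (d : ℕ) (φ : A ⟶ A) :
    ∀ c : complexBetti A.X (2 * 3), IsRationalClass c → IsOfHodgeType (2 * 3) A.X (2 * 3) 3 3 c →
      c ∈ weilClassesOf A φ 3 d → c ∈ algebraicClasses A.X 3 := by
  intro c hc hH _
  refine hodgeClasses_algebraic_isogenyFactor_sq_simpleThreefold hTR T hT hs A i q n hn hiq 3 c hc ?_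
  rw [hA]
  exact hH

/-- **Rung R1′ (`NonsplitSixfolds`) AT the sixfolds that are isogeny factors of `T × T`, `T` a simple
threefold**: its body verbatim (the non-hyperbolicity hypothesis is carried and NOT used — the conclusion
holds for every `φ`). By the discriminant count of the module docstring these include members of EVERY
non-split component `(K, 3, δ ≠ -1)`, for every `K`: a classical (1982/83, refereed) sub-case of R1′ on a
`2`-dimensional locus; R1′ for the general member is untouched. Modulo Tankeev–Ribet only.
[cite: MoonenZarhin1999LowDim, §2 Thm. (2.7)] [cite: Markman2025SurveySecant, §1.1 and §11.5 Step 1] -/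
theorem nonsplitSixfolds_body_of_isogenyFactor_sq_simpleThreefold
    (hTR : TankeevRibet1983_hodgeClasses_divisorial_powers_simplePrimeDimension)
    (T : AbelianVariety ℂ) (hT : T.dim = 3) (hs : T.IsSimple)
    (A : AbelianVariety ℂ) (i : A ⟶ T.prod T) (q : T.prod T ⟶ A) (n : ℕ) (hn : 0 < n)
    (hiq : i ≫ q = n • 𝟙 A) :
    ∀ (d : ℕ), 0 < d → ∀ (φ : A ⟶ A), A.dim = 2 * 3 →
      Motives.IsSmoothProjective (2 * 3) A.X → φ ≫ φ = -(d • 𝟙 A) →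
        (∀ (e : Motives.ProjectiveEmbedding A.X) (a : complexBetti (Motives.projectiveSpace e.n ℂ) 2),
          IsRationalClass a → a ≠ 0 →
            ¬ Motives.IsHyperbolicWeilType A φ 3
              ((d : ℂ) • complexBetti.map e.ι 2 a +
                complexBetti.map φ.hom.hom.hom 2 (complexBetti.map e.ι 2 a))) →
          ∀ c : complexBetti A.X (2 * 3), IsRationalClass c → IsOfHodgeType (2 * 3) A.X (2 * 3) 3 3 c →
            c ∈ weilClassesOf A φ 3 d → c ∈ algebraicClasses A.X 3 :=
  fun d _ φ hA _ _ _ ↦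
    weilClasses_algebraic_sixfold_of_isogenyFactor_sq_simpleThreefold hTR T hT hs A i q n hn hiq hA d φ

/-- **Rung R6 (`AbelianSixfolds`: the Hodge conjecture for every complex abelian sixfold) AT the sixfolds that
are isogeny factors of `T × T`, `T` a simple threefold** — its body verbatim; a conforming stratum of the R6
census (`K`-isotypic sixfolds of threefold type), modulo Tankeev–Ribet.
[cite: MoonenZarhin1999LowDim, §2 Thm. (2.7)] -/
theorem abelianSixfolds_body_of_isogenyFactor_sq_simpleThreefold
    (hTR : TankeevRibet1983_hodgeClasses_divisorial_powers_simplePrimeDimension)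
    (T : AbelianVariety ℂ) (hT : T.dim = 3) (hs : T.IsSimple)
    (A : AbelianVariety ℂ) (i : A ⟶ T.prod T) (q : T.prod T ⟶ A) (n : ℕ) (hn : 0 < n)
    (hiq : i ≫ q = n • 𝟙 A) :
    A.dim = 6 → IsSmoothProjective A.dim A.X → HodgeConjectureFor A.dim A.X :=
  fun _ _ ↦ hodgeConjectureFor_isogenyFactor_sq_simpleThreefold hTR T hT hs A i q n hn hiq

/-! ### The Weil plane as a submodule (balanced `φ`), and EIGHTFOLDS `A × S` -/

/-- **`W_K(A) ⊗ ℂ ⊆ N³`** for `A` an isogeny factor of `T × T` (`T` a simple threefold) of dimension `6` and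
`φ² = -d` of BALANCED type `(3,3)` (`dim (V₊ ∩ H^{1,0}) = 3`; e.g. the twisted squares `(T × T, ι × ῑ)`): the
submodule shape consumed by the product step, via the tree's bridge
`weilClassesOf_le_algebraicClasses_of_forall_isRationalClass` (van Geemen 4.9 + Deligne–Milne 4.4).
[cite: MoonenZarhin1999LowDim, §2 Thm. (2.7)] [cite: vanGeemen1994HodgeAV, 4.9–4.10] -/
theorem weilClassesOf_le_algebraicClasses_of_isogenyFactor_sq_simpleThreefold
    (hTR : TankeevRibet1983_hodgeClasses_divisorial_powers_simplePrimeDimension)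
    (T : AbelianVariety ℂ) (hT : T.dim = 3) (hs : T.IsSimple)
    (A : AbelianVariety ℂ) (i : A ⟶ T.prod T) (q : T.prod T ⟶ A) (n : ℕ) (hn : 0 < n)
    (hiq : i ≫ q = n • 𝟙 A) (hA : A.dim = 2 * 3) {d : ℕ} (hd : 0 < d) {φ : A ⟶ A}
    (hφ : φ ≫ φ = -(d • 𝟙 A))
    (hbal : Module.finrank ℂ ↥(Module.End.eigenspace (complexBetti.map φ.hom.hom.hom 1).hom
          (Complex.I * (Real.sqrt d : ℂ)) ⊓ hodgeOneZero (Motives.isSmoothProjective_of_dim_eq' hA)) = 3) :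
    weilClassesOf A φ 3 d ≤ algebraicClasses A.X 3 :=
  weilClassesOf_le_algebraicClasses_of_forall_isRationalClass (by norm_num) hA hd hφ hbal
    (weilClasses_algebraic_sixfold_of_isogenyFactor_sq_simpleThreefold hTR T hT hs A i q n hn hiq hA d φ)

variable {S : AbelianVariety ℂ} in
/-- **Rung R2₈ (`SplitEightfolds`) / R∞ at `n = 4` on the EIGHTFOLDS `A × S`** — `A` a `6`-dimensional isogeny
factor of `T × T` (`T` a simple threefold) with `φ² = -d` balanced, `S` an abelian SURFACE with `ψ² = -d` of
type `(1,1)`: every rational `(4,4)`-class of the Weil plane of `(A × S, φ × ψ)` is algebraic, by the tree's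
downward product step (`weilClassesOf_prod_le_algebraicClasses`, Schoen 1998 §10 read downward) fed with
the previous theorem and with the unconditional surface case. Trust base {Tankeev–Ribet, Lefschetz (1,1)}:
no Markman, no Schoen, every `K`; no hypothesis on polarizations (discriminants multiply: with `A = T × T̄` and
`S ∈ {E², S_D}` every eightfold class `δ` is reached — `3`-dimensional loci in the `16`-dimensional components).
[cite: MoonenZarhin1999LowDim, §2 Thm. (2.7)] [cite: Schoen1998HodgeWeilAddendum, §10]
[cite: Markman2025SurveySecant, §11.5 Steps 1–2] -/
theorem splitEightfolds_body_sqSimpleThreefold_prod_surface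
    (hTR : TankeevRibet1983_hodgeClasses_divisorial_powers_simplePrimeDimension)
    (T : AbelianVariety ℂ) (hT : T.dim = 3) (hs : T.IsSimple)
    (A : AbelianVariety ℂ) (i : A ⟶ T.prod T) (q : T.prod T ⟶ A) (n : ℕ) (hn : 0 < n)
    (hiq : i ≫ q = n • 𝟙 A) (hA : A.dim = 2 * 3) {d : ℕ} (hd : 0 < d) {φ : A ⟶ A}
    (hφ : φ ≫ φ = -(d • 𝟙 A))
    (hbal : Module.finrank ℂ ↥(Module.End.eigenspace (complexBetti.map φ.hom.hom.hom 1).hom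
          (Complex.I * (Real.sqrt d : ℂ)) ⊓ hodgeOneZero (Motives.isSmoothProjective_of_dim_eq' hA)) = 3)
    (hS : S.dim = 2 * 1) {ψ : S ⟶ S} (hψ : ψ ≫ ψ = -(d • 𝟙 S))
    (hSbal : Module.finrank ℂ ↥(Module.End.eigenspace (complexBetti.map ψ.hom.hom.hom 1).hom
          (Complex.I * (Real.sqrt d : ℂ)) ⊓ hodgeOneZero (Motives.isSmoothProjective_of_dim_eq' hS)) = 1) :
    ∀ c : complexBetti (A.prod S).X (2 * 4), IsRationalClass c →
      IsOfHodgeType (2 * 4) (A.prod S).X (2 * 4) 4 4 c →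
        c ∈ weilClassesOf (A.prod S)
          (AbelianVariety.prodLift (AbelianVariety.fst A S ≫ φ) (AbelianVariety.snd A S ≫ ψ)) 4 d →
          c ∈ algebraicClasses (A.prod S).X 4 :=
  fun _ _ _ hcW ↦
    weilClassesOf_prod_le_algebraicClasses (by norm_num) hd hA hS hφ hψ
      (weilClassesOf_le_algebraicClasses_of_isogenyFactor_sq_simpleThreefold hTR T hT hs A i q n hn hiq hA
        hd hφ hbal)
      (weilClassesOf_le_algebraicClasses_surface hS hd hψ hSbal) hcW

/-! ### On-path lemmas (forward contract `<R>_of_HodgeConjecture`) -/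

/-- **On-path (sixfolds)**: the Hodge conjecture implies the R1-body statement at every sixfold and every `φ`
(via R∞ = `WeilClassesImaginaryQuadratic` at `n = 3`); the instances above are CASES of the summit.
[cite: Deligne2000, §1] -/
theorem weilClasses_algebraic_sixfold_of_hodgeConjecture (h : _root_.HodgeConjecture)
    (A : AbelianVariety ℂ) (hA : A.dim = 2 * 3) {d : ℕ} (hd : 0 < d) {φ : A ⟶ A}
    (hφ : φ ≫ φ = -(d • 𝟙 A)) :
    ∀ c : complexBetti A.X (2 * 3), IsRationalClass c → IsOfHodgeType (2 * 3) A.X (2 * 3) 3 3 c →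
      c ∈ weilClassesOf A φ 3 d → c ∈ algebraicClasses A.X 3 :=
  weilClassesImaginaryQuadratic_of_hodgeConjecture h 3 (by norm_num) d hd A φ hA
    (Motives.isSmoothProjective_of_dim_eq' hA) hφ

variable {S : AbelianVariety ℂ} in
/-- **On-path (eightfolds `A⁶ × S²`)**: the Hodge conjecture implies the R2₈-body statement on every such
product (`splitEightfolds_prod_of_hodgeConjecture` of `Theorems/WeilTypeLadderProducts` at `3 + 1 = 4`).
[cite: Deligne2000, §1] -/
theorem splitEightfolds_sixfoldProdSurface_of_hodgeConjecture (h : _root_.HodgeConjecture)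
    (A : AbelianVariety ℂ) (hA : A.dim = 2 * 3) (hS : S.dim = 2 * 1) {d : ℕ} (hd : 0 < d) {φ : A ⟶ A}
    {ψ : S ⟶ S} (hφ : φ ≫ φ = -(d • 𝟙 A)) (hψ : ψ ≫ ψ = -(d • 𝟙 S)) :
    ∀ c : complexBetti (A.prod S).X (2 * 4), IsRationalClass c →
      IsOfHodgeType (2 * 4) (A.prod S).X (2 * 4) 4 4 c →
        c ∈ weilClassesOf (A.prod S)
          (AbelianVariety.prodLift (AbelianVariety.fst A S ≫ φ) (AbelianVariety.snd A S ≫ ψ)) 4 d →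
          c ∈ algebraicClasses (A.prod S).X 4 :=
  splitEightfolds_prod_of_hodgeConjecture h (show 3 + 1 = 4 from rfl) hd hA hS hφ hψ

end Summit.HodgeConjecture.HodgeConjecture.WeilTypeLadder

end
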